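import Summits.CriticalPhenomena.PercolationContinuityZ3.Theorems.PercNearOneGluingNoHeavyLowerTailKNGoodPortFree
import Summits.CriticalPhenomena.PercolationContinuityZ3.Theorems.PercNearOneGluingNoHeavyLowerTailKNGoodSeriesEasy
import HarnessLib

/-!
# Kozma–Nitzan goodness for an observer with TWO LONELY multi-port pendant stars on a hub-star core
# (`NoHeavyLowerTail` cell, stmt-CriticalPhenomena-4575; prover `prim-hp-2`, deletion–contraction line, gen 4)

Support file (`--supports stmt-CriticalPhenomena-4575`).  No definitions, no named facts, no sorries.
The "two-lonely-children kernel" (lead memo LEAD-GEN7 §3a) on the apex-forest core: `o ∉ A` joined to relays (hairs) and to two pendant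
relay-stars `x, y` with ARBITRARY port sets and weights (shared ports allowed), every relay `a ≠ b` joined otherwise only to the hub `b`.
Kozma–Nitzan's Theorem 5 is ONE child; `KNGoodSeriesEasy.knGood_twoStars_hairs_of_notLonelier` needs a child no lonelier than the loneliest
relay; here both children may be lonelier than every relay.  Proof = the series identity (`KNGoodSeries.knGood_series_of_gluing`) + the
port-free witness reduction and the gain-free witness theorem (`KNGoodPortFree.gc_of_hairless_noGain`): after deleting its hairs the
`G − o`-loneliest relay `a₀` is joined only to `b`, so it gains nothing from gluing `x` with `y`.

* `KNGoodHubStar.real_openConn_eq_of_bare` — a vertex whose only positive pair is to `b` reaches `b` with probability that weight.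
* `KNGoodHubStar.knGood_twoStars_hubStar` — the theorem.
-/

noncomputable section

namespace Summit.CriticalPhenomena.PercolationContinuityZ3.Theorems

open MeasureTheory Set Literature.Probability.LatticeModels Literature.Probability.Percolation
open scoped Classical BigOperators

variable {n : ℕ}

namespace KNGoodHubStar

open ChampionStability KNGoodAux KNGoodHair RelayNbhd KNGoodSeries KNGoodSeriesEasy KNGoodLoser KNGoodPortFree

/-- **A bare vertex**: if every pair at `a` other than `s(a,b)` has weight `0` (`a ≠ b`), then `P(a ↔ b) = w s(a,b)`. [folklore] -/
theorem real_openConn_eq_of_bare (w : Sym2 (Fin n) → unitInterval) (a b : Fin n) (hab : a ≠ b)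
    (hbare : ∀ z : Fin n, z ≠ a → z ≠ b → w s(a, z) = 0) :
    (prodBernoulli w).real (openConn a b) = w s(a, b) := by
  haveI : IsProbabilityMeasure (prodBernoulli w) := inferInstance
  set F : Finset (Sym2 (Fin n)) :=
    ((Finset.univ : Finset (Fin n)).filter (fun z => z ≠ a ∧ z ≠ b)).image (fun z => s(a, z)) with hF
  have hN0 : (prodBernoulli w).real {ω : BondConfig (Fin n) | ∃ e ∈ F, e ∈ ω} = 0 := by
    have h0 : prodBernoulli w {ω : BondConfig (Fin n) | ∃ e ∈ F, e ∈ ω} = 0 := by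
      refine prodBernoulli_setOf_exists_mem_eq_zero w F fun e he => ?_
      obtain ⟨z, hz, rfl⟩ := Finset.mem_image.1 he
      have hz' := (Finset.mem_filter.1 hz).2
      rw [hbare z hz'.1 hz'.2]; rfl
    rw [measureReal_def, h0, ENNReal.toReal_zero]
  have hsub : (openConn a b : Set (BondConfig (Fin n))) ⊆ {ω | s(a, b) ∈ ω} ∪ {ω | ∃ e ∈ F, e ∈ ω} := by
    intro ω hω
    obtain ⟨p⟩ := (hω : (openGraph ω).Reachable a b)
    cases p with
    | nil => exact absurd rfl hab
    | @cons _ z _ hadj _ =>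
      rw [openGraph_adj] at hadj
      by_cases hzb : z = b
      · left; rw [← hzb]; exact hadj.1
      · right
        exact ⟨s(a, z), Finset.mem_image.2 ⟨z, Finset.mem_filter.2 ⟨Finset.mem_univ _, Ne.symm hadj.2, hzb⟩, rfl⟩, hadj.1⟩
  have hsup : {ω : BondConfig (Fin n) | s(a, b) ∈ ω} ⊆ openConn a b := by
    intro ω hω
    show (openGraph ω).Reachable a b
    exact SimpleGraph.Adj.reachable ((openGraph_adj ω a b).2 ⟨hω, hab⟩)
  have h1 : (prodBernoulli w).real (openConn a b) ≤ w s(a, b) := by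
    calc (prodBernoulli w).real (openConn a b)
        ≤ (prodBernoulli w).real ({ω : BondConfig (Fin n) | s(a, b) ∈ ω} ∪ {ω | ∃ e ∈ F, e ∈ ω}) := measureReal_mono hsub
      _ ≤ (prodBernoulli w).real {ω : BondConfig (Fin n) | s(a, b) ∈ ω} +
            (prodBernoulli w).real {ω : BondConfig (Fin n) | ∃ e ∈ F, e ∈ ω} := measureReal_union_le _ _
      _ = w s(a, b) := by rw [hN0, add_zero, prodBernoulli_real_setOf_mem]
  have h2 : (w s(a, b) : ℝ) ≤ (prodBernoulli w).real (openConn a b) := by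
    rw [← prodBernoulli_real_setOf_mem w s(a, b)]
    exact measureReal_mono hsup
  exact le_antisymm h1 h2

/-- **Goodness for an observer with relay hairs and two pendant relay-stars on a hub-star core.**  `o ∉ A`, `b ∉ {o, x, y}`; `x ≠ y`
not in `A`, `≠ o`, not adjacent; positive pairs at `o` go into `A ∪ {x, y}`, at `x` into `A ∪ {o}`, at `y` into `A ∪ {o}` (pendant stars,
any port sets, hair weights `< 1`); every relay `a ≠ b` has positive pairs only to `b, o, x, y` (hub-star core); some relay differs from
`b`.  Then `(G, A, o, b)` is good (Kozma–Nitzan); in particular `P(o ↔ b) ≥ P(o ↔ A, a ↔ b)` for some `a ∈ A` (`KNGood.preFKG2`) and their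
Conjecture 1 holds at `o` — with BOTH children allowed to be lonelier in `G − o` than every relay.
[cite: KozmaNitzan2024, Thm. 4 (p. 12), Thm. 5 (p. 13), Conjecture 1 (p. 3) — extension] -/
theorem knGood_twoStars_hubStar (w : Sym2 (Fin n) → unitInterval) (A : Finset (Fin n)) (hA : A.Nonempty)
    (o x y b : Fin n) (ho : o ∉ A) (hx : x ∉ A) (hy : y ∉ A) (hxo : x ≠ o) (hyo : y ≠ o) (hxy : x ≠ y)
    (hbo : b ≠ o) (hbx : b ≠ x) (hby : b ≠ y) (hAb : ∃ a ∈ A, a ≠ b) (hxyw : w s(x, y) = 0)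
    (hoN : ∀ v : Fin n, v ≠ o → v ∉ A → v ≠ x → v ≠ y → w s(o, v) = 0)
    (hxN : ∀ u : Fin n, u ≠ x → u ∉ A → u ≠ o → w s(x, u) = 0)
    (hyN : ∀ u : Fin n, u ≠ y → u ∉ A → u ≠ o → w s(y, u) = 0)
    (hx1 : ∀ a ∈ A, (w s(x, a) : ℝ) < 1) (hy1 : ∀ a ∈ A, (w s(y, a) : ℝ) < 1)
    (hhub : ∀ a ∈ A, a ≠ b → ∀ z : Fin n, z ≠ a → z ≠ b → z ≠ o → z ≠ x → z ≠ y → w s(a, z) = 0) :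
    KNGood w A hA o b := by
  -- delete the hairs at `o`
  set w' : Sym2 (Fin n) → unitInterval := fun e => if ∃ p ∈ A, e = s(o, p) then 0 else w e with hw'
  refine knGood_of_deleteHairs w A hA o b ho ?_
  rw [← hw']
  have hpin : pinW w' {e : Sym2 (Fin n) | o ∈ e ∧ ¬ e.IsDiag} ∅ = pinW w {e : Sym2 (Fin n) | o ∈ e ∧ ¬ e.IsDiag} ∅ := by
    refine pinW_star_eq_of_eqOff w w' o fun e he => ?_
    rw [hw']; simp only
    rw [if_neg]
    rintro ⟨p, hp, rfl⟩
    exact he ⟨Sym2.mem_mk_left o p, fun hd => ho ((Sym2.mk_isDiag_iff.1 hd) ▸ hp)⟩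
  set u := pinW w {e : Sym2 (Fin n) | o ∈ e ∧ ¬ e.IsDiag} ∅ with hu
  have huoff : ∀ p q : Fin n, p ≠ o → q ≠ o → u s(p, q) = w s(p, q) := by
    intro p q hp hq
    have hmem : s(p, q) ∉ {e : Sym2 (Fin n) | o ∈ e ∧ ¬ e.IsDiag} := by
      rintro ⟨hoe, -⟩
      rcases Sym2.mem_iff.1 hoe with h | h
      · exact hp h.symm
      · exact hq h.symm
    rw [hu, pinW_apply_of_not_mem w ∅ hmem]
  have huo : ∀ v : Fin n, v ≠ o → u s(v, o) = 0 := by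
    intro v hv; rw [Sym2.eq_swap, hu]; exact pinW_star_mk w hv
  -- Theorem 4 for the pendant stars `x`, `y` of `G − o`
  have hgoodx : KNGood u A hA x b := by
    refine KozmaNitzan2024_thm4_good u A hA x b hx fun q hqx hqA => ?_
    by_cases hqo : q = o
    · rw [hqo]; exact huo x hxo
    · by_cases hqy : q = y
      · rw [hqy, huoff x y hxo hyo]; exact hxyw
      · rw [huoff x q hxo hqo]; exact hxN q hqx hqA hqo
  have hgoody : KNGood u A hA y b := by
    refine KozmaNitzan2024_thm4_good u A hA y b hy fun q hqy hqA => ?_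
    by_cases hqo : q = o
    · rw [hqo]; exact huo y hyo
    · by_cases hqx : q = x
      · rw [hqx, Sym2.eq_swap, huoff x y hxo hyo]; exact hxyw
      · rw [huoff y q hyo hqo]; exact hyN q hqy hqA hqo
  -- the minimiser `a₀ ≠ b` of `P_{G−o}(· ↔ b)`
  obtain ⟨a₁, ha₁, hmin₁⟩ := A.exists_min_image (fun a => (prodBernoulli u).real (openConn a b)) hA
  haveI : IsProbabilityMeasure (prodBernoulli u) := inferInstance
  obtain ⟨a₀, ha₀, ha₀b, hmin⟩ : ∃ a₀ ∈ A, a₀ ≠ b ∧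
      ∀ a' ∈ A, (prodBernoulli u).real (openConn a₀ b) ≤ (prodBernoulli u).real (openConn a' b) := by
    by_cases h : a₁ = b
    · obtain ⟨a₂, ha₂, ha₂b⟩ := hAb
      refine ⟨a₂, ha₂, ha₂b, fun a' ha' => ?_⟩
      have h1 : (prodBernoulli u).real (openConn a₁ b) = 1 := by
        rw [h]
        have : (openConn b b : Set (BondConfig (Fin n))) = univ :=
          eq_univ_of_forall fun ω => (SimpleGraph.Reachable.refl b : (openGraph ω).Reachable b b)
        rw [this, probReal_univ]
      calc (prodBernoulli u).real (openConn a₂ b) ≤ 1 := measureReal_le_one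
        _ = (prodBernoulli u).real (openConn a₁ b) := h1.symm
        _ ≤ (prodBernoulli u).real (openConn a' b) := hmin₁ a' ha'
    · exact ⟨a₁, ha₁, h, hmin₁⟩
  have hxa : x ≠ a₀ := fun h => hx (h ▸ ha₀)
  have hya : y ≠ a₀ := fun h => hy (h ▸ ha₀)
  have hao : a₀ ≠ o := fun h => ho (h ▸ ha₀)
  -- the glued graph `(G − o) + xy` and the hairless versions
  set us := Function.update u s(x, y) 1 with hus
  have hglue : us s(x, y) = 1 := by rw [hus, Function.update_self]
  have hne_xy_xa : s(x, y) ≠ s(x, a₀) := fun h => hya (Sym2.congr_right.1 h)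
  have hne_xy_ya : s(x, y) ≠ s(y, a₀) := by
    intro h; rcases Sym2.eq_iff.1 h with ⟨h1, -⟩ | ⟨h1, -⟩
    · exact hxy h1
    · exact hxa h1
  have hne_xa_ya : s(x, a₀) ≠ s(y, a₀) := fun h => hxy (Sym2.congr_left.1 h)
  have husoff : ∀ e : Sym2 (Fin n), e ≠ s(x, y) → us e = u e := fun e he => by rw [hus, Function.update_of_ne he]
  -- the two remaining hypotheses of `gc_of_hairless_noGain`, proved below
  have key : KNGood (Function.update (Function.update us s(x, a₀) 0) s(y, a₀) 0) A hA x b ∧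
      (prodBernoulli (Function.update (Function.update us s(x, a₀) 0) s(y, a₀) 0)).real (openConn a₀ b) ≤
        (prodBernoulli (Function.update (Function.update u s(x, a₀) 0) s(y, a₀) 0)).real (openConn a₀ b) := by
    constructor
    · -- `KNGood` of the glued hairless star: Theorem 5 (twin `y`) + Theorem 4 (for `y` with `x` deleted)
      set us' := Function.update (Function.update us s(x, a₀) 0) s(y, a₀) 0 with hus'
      have hus'x : ∀ q : Fin n, q ≠ a₀ → q ≠ y → us' s(x, q) = u s(x, q) := by
        intro q hqa hqy
        have h1 : s(x, q) ≠ s(y, a₀) := by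
          intro h; rcases Sym2.eq_iff.1 h with ⟨h2, -⟩ | ⟨h2, -⟩
          · exact hxy h2
          · exact hxa h2
        have h2 : s(x, q) ≠ s(x, a₀) := fun h => hqa (Sym2.congr_right.1 h)
        have h3 : s(x, q) ≠ s(x, y) := fun h => hqy (Sym2.congr_right.1 h)
        rw [hus', Function.update_of_ne h1, Function.update_of_ne h2, husoff _ h3]
      have hus'y : ∀ q : Fin n, q ≠ a₀ → q ≠ x → us' s(y, q) = u s(y, q) := by
        intro q hqa hqx
        have h1 : s(y, q) ≠ s(y, a₀) := fun h => hqa (Sym2.congr_right.1 h)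
        have h2 : s(y, q) ≠ s(x, a₀) := by
          intro h; rcases Sym2.eq_iff.1 h with ⟨h3, -⟩ | ⟨h3, -⟩
          · exact hxy h3.symm
          · exact hya h3
        have h3 : s(y, q) ≠ s(x, y) := by
          intro h; rcases Sym2.eq_iff.1 h with ⟨h4, -⟩ | ⟨-, h4⟩
          · exact hxy h4.symm
          · exact hqx h4
        rw [hus', Function.update_of_ne h1, Function.update_of_ne h2, husoff _ h3]
      refine KozmaNitzan2024_thm5 us' A hA x b y hx hbx (Ne.symm hxy) (fun q hqx hqA hqy => ?_) ?_
      · have hqa : q ≠ a₀ := fun h => hqA (h ▸ ha₀)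
        rw [hus'x q hqa hqy]
        by_cases hqo : q = o
        · rw [hqo]; exact huo x hxo
        · rw [huoff x q hxo hqo]; exact hxN q hqx hqA hqo
      · refine KozmaNitzan2024_thm4_good (restrW ({x}ᶜ : Set (Fin n)) us') A hA y b hy fun q hqy hqA => ?_
        by_cases hqx : q = x
        · rw [hqx]
          refine restrW_apply_of_not_mem us' fun hmem => ?_
          exact (hmem.1 x (Sym2.mem_mk_right y x)) rfl
        · have hmem : s(y, q) ∈ wireSet ({x}ᶜ : Set (Fin n)) := by
            refine ⟨fun z hz => ?_, fun hd => hqy (Sym2.mk_isDiag_iff.1 hd).symm⟩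
            rcases Sym2.mem_iff.1 hz with h | h
            · rw [h]; exact fun h' => hxy (h' : y = x).symm
            · rw [h]; exact hqx
          have hqa : q ≠ a₀ := fun h => hqA (h ▸ ha₀)
          rw [restrW_apply_of_mem us' hmem, hus'y q hqa hqx]
          by_cases hqo : q = o
          · rw [hqo]; exact huo y hyo
          · rw [huoff y q hyo hqo]; exact hyN q hqy hqA hqo
    · -- no gain: `a₀` is bare (only the pair to `b`) in both hairless graphs, with the same weight there
      set us' := Function.update (Function.update us s(x, a₀) 0) s(y, a₀) 0 with hus'
      set u' := Function.update (Function.update u s(x, a₀) 0) s(y, a₀) 0 with hu'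
      have hab_ne1 : s(a₀, b) ≠ s(y, a₀) := by
        intro h; rcases Sym2.eq_iff.1 h with ⟨h1, -⟩ | ⟨-, h1⟩
        · exact hya h1.symm
        · exact hby h1
      have hab_ne2 : s(a₀, b) ≠ s(x, a₀) := by
        intro h; rcases Sym2.eq_iff.1 h with ⟨h1, -⟩ | ⟨-, h1⟩
        · exact hxa h1.symm
        · exact hbx h1
      have hab_ne3 : s(a₀, b) ≠ s(x, y) := by
        intro h; rcases Sym2.eq_iff.1 h with ⟨h1, -⟩ | ⟨h1, -⟩
        · exact hxa h1.symm
        · exact hya h1.symm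
      have hbare : ∀ (v : Sym2 (Fin n) → unitInterval), (∀ e, e ≠ s(x, y) → v e = u e) →
          ∀ z : Fin n, z ≠ a₀ → z ≠ b → Function.update (Function.update v s(x, a₀) 0) s(y, a₀) 0 s(a₀, z) = 0 := by
        intro v hv z hza hzb
        by_cases hzy : z = y
        · rw [hzy, show s(a₀, y) = s(y, a₀) from Sym2.eq_swap, Function.update_self]
        · have h1 : s(a₀, z) ≠ s(y, a₀) := by
            intro h; rcases Sym2.eq_iff.1 h with ⟨h2, -⟩ | ⟨-, h2⟩
            · exact hya h2.symm
            · exact hzy h2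
          rw [Function.update_of_ne h1]
          by_cases hzx : z = x
          · rw [hzx, show s(a₀, x) = s(x, a₀) from Sym2.eq_swap, Function.update_self]
          · have h2 : s(a₀, z) ≠ s(x, a₀) := by
              intro h; rcases Sym2.eq_iff.1 h with ⟨h3, -⟩ | ⟨-, h3⟩
              · exact hxa h3.symm
              · exact hzx h3
            have h3 : s(a₀, z) ≠ s(x, y) := by
              intro h; rcases Sym2.eq_iff.1 h with ⟨h4, -⟩ | ⟨h4, -⟩
              · exact hxa h4.symm
              · exact hya h4.symm
            rw [Function.update_of_ne h2, hv _ h3]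
            by_cases hzo : z = o
            · rw [hzo]; exact huo a₀ hao
            · rw [huoff a₀ z hao hzo]; exact hhub a₀ ha₀ ha₀b z hza hzb hzo hzx hzy
      have h1 : (prodBernoulli us').real (openConn a₀ b) = us' s(a₀, b) :=
        real_openConn_eq_of_bare us' a₀ b ha₀b (by rw [hus']; exact hbare us husoff)
      have h2 : (prodBernoulli u').real (openConn a₀ b) = u' s(a₀, b) :=
        real_openConn_eq_of_bare u' a₀ b ha₀b (by rw [hu']; exact hbare u (fun e _ => rfl))
      have h3 : us' s(a₀, b) = u' s(a₀, b) := by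
        rw [hus', hu', Function.update_of_ne hab_ne1, Function.update_of_ne hab_ne2, Function.update_of_ne hab_ne1,
          Function.update_of_ne hab_ne2, husoff _ hab_ne3]
      rw [h1, h2, h3]
  have hGC := gc_of_hairless_noGain u us A hA x y a₀ b hxa hya hxy ha₀ hglue
    (fun e => by
      by_cases he : e = s(x, y)
      · rw [he, hglue]; exact le_top
      · rw [husoff e he])
    (by rw [husoff _ (Ne.symm hne_xy_xa)]) (by rw [husoff _ (Ne.symm hne_xy_ya)])
    (by rw [huoff x a₀ hxo hao]; exact hx1 a₀ ha₀) (by rw [huoff y a₀ hyo hao]; exact hy1 a₀ ha₀) hmin key.1 key.2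
  rw [hus] at hGC
  exact knGood_series_of_gluing w' A hA o x y a₀ b ho hxo hyo hxy ha₀ hbo
    (fun v hvo hvx hvy => by
      rw [hw']; simp only
      by_cases hvA : v ∈ A
      · rw [if_pos ⟨v, hvA, rfl⟩]; rfl
      · rw [if_neg]
        · exact congrArg Subtype.val (hoN v hvo hvA hvx hvy)
        · rintro ⟨p, hp, hvp⟩
          exact hvA ((Sym2.congr_right.1 hvp) ▸ hp))
    (by rw [hpin]; exact hmin) (by rw [hpin]; exact hgoodx) (by rw [hpin]; exact hgoody) (by rw [hpin]; linarith [hGC])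

end KNGoodHubStar

end Summit.CriticalPhenomena.PercolationContinuityZ3.Theorems

end
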